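import Mathlib
import HarnessLib
import Summits.NavierStokesRegularity.NavierStokesRegularity.Theorems.PoloidalWindowDoorLrcModEntireFermiTimeWebGeometry
import Summits.NavierStokesRegularity.NavierStokesRegularity.Theorems.PoloidalWindowDoorLrcModEntireCurvedHuygensLocal
import Summits.NavierStokesRegularity.NavierStokesRegularity.Theorems.PoloidalWindowDoorLrcModEntireWebPackageAnalytic

/-!
# Route `PoloidalWindowDoor`, item `LrcModEntire` (stmt-NavierStokesRegularity-20428), cell (Q4-sonic, straight, μ < 0) `stub_Q4sonicLineNeg`, case II —
# BRICK B-TWPc, PART T3b-2: THE CURVED TIME-WEB PACKAGE AT A GENERAL BASE TIME (identities at the Fermi points, the Fermi Huygens family, parallel webs)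

Cell ns-regularity-ideate, stub-worker seat ns-poloidal-K2-p2 g18 under the LEAD of item 20428 (ns-poloidal-K2-p3 g17/g18);
`--supports stmt-NavierStokesRegularity-20428 --as helper`.  Memo `Cruxes/LrcModEntire/TOWER-CLOSES-port2g9.md` §D2/§E («B-TWPc = the curved time-web package at
a general base time, L»), LEAD 2026-08-29T23:13:57Z (v15: close `stub_Q4sonicLineNegIsolated` through the curved END at ONE small non-sonic time), this seat's design
word 23:29Z (LOCAL in σ) and the refuter1/idea-crit-7 tripwire «no `τ = 0` normalisation hypothesis»: NONE is used below — only class data, the slab law, the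
frame-form concavity on the `δ`-box and the `δ′`-box space–time web package `hpack` of the curved END `…CaseIIEntranceSharp.caseII_false_of_curvedEnd'`, at an
ARBITRARY base time `τ₁` with `|τ₁| < δ′`.

★ `fermi_timeWeb_package` — given the unit-speed base web `Γ` of time `τ₁` (T1, `…BaseWebArclength`, passed BY VALUE so that all base points share it) and a base
point `σ₀`: a box `B = {|τ−τ₁|, |σ−σ₀|, |z| < ε₁}` inside the `δ′`-slab and the local Fermi-frame time-web function `G₁ ∈ C^∞(B)` (T3b-1) with the pin
`G₁(τ₁,σ,0) = 0`, the Fermi factor `1 − k₁G₁ ≠ 0`, the LINE PARAMETER `S` with `Γσ + G₁(q)·JΓ′σ + z·e₂ = frameCLM e (S q, n₀(τ, S q, z), z)` (so the assembly can pull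
any further line-frame fact of the END — e.g. the space–time web Fermat law — to the Fermi points), and at every `q = (τ,σ,z) ∈ B`, for `F_τ = σ·U₂(−1+τ,·)`, `B_q = D²F_τ` at the Fermi point
`P(q) = Γσ + G₁(q)·JΓ′σ + z·e₂`: CRITICALITY `DF_τ(P)[JΓ′σ] = DF_τ(P)[Γ′σ] = 0`, VALUE `F_τ(P) = R(τ,z)`, RIDGE LAW `B_q(Γ′,Γ′) + B_q(JΓ′,JΓ′) = −κt(τ,z)`, SLICE LAW
`B_q(e₂,e₂) = −μ(−1+τ,z)(B_q(Γ′,Γ′) + B_q(JΓ′,JΓ′))` (all transferred from `hpack` at the line parameter `S q` of T3b-1; `frame_trace`, `slice_law_at`); the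
FERMI HUYGENS FAMILY `κt(τ,z)(1 − k₁(σ)G₁)²(∂_zG₁)² = (R_zz(τ,z) − μ(−1+τ,z)κt(τ,z))((1 − k₁(σ)G₁)² + (∂_σG₁)²)` on `B` (T3a `curved_huygens_identity_on`, `R(τ,·)`
analytic by `ridgeHeight_analyticAt`) — this is port-2 g9's `…CurvedTimeSplit.curved_webSpeed_split` input `hH` after the time shift `τ ↦ τ − τ₁` —; and PARALLEL WEBS
at the base time, `G₁(τ₁,σ,z) = G₁(τ₁,σ′,z)` on the box (T3a `webFun_eq_of_curved_huygens_on`; differentiability of `κt(τ₁,·)` from the ridge law as a composition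
with the analytic web function, `…Q4TimeWebFunction.differentiableAt_sliceHessian_comp`).  The parallel offset of TOWER-CLOSES §D2 is `d₁(z) := G₁(τ₁,σ₀,z)`.

WHAT THIS IS NOT: not a claim about Navier–Stokes regularity; closes nothing (the non-verticality `d₁′(0) ≠ 0` for small `τ₁` is T4; the assembly with B-SPEEDc/
B-JETc/B-CRc/B-TSPLITc/B-ELIM/B-POLE is port-2 g9's); items 20428 / 19708 / 27893 OPEN (bears_on LADDER-NS N0).
-/

noncomputable section

set_option linter.dupNamespace false
set_option linter.style.longLine false

namespace Summit.NavierStokesRegularity.NavierStokesRegularity.Theorems.PoloidalWindowDoorLrcModEntireFermiTimeWebPackage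

open Set Function Filter Topology Metric
open scoped RealInnerProductSpace InnerProductSpace ContDiff
open Literature.Analysis Literature.Analysis.FluidPDE Literature.Analysis.UnboundedOperators
open Summit.NavierStokesRegularity.NavierStokesRegularity.Theorems
open Summit.NavierStokesRegularity.NavierStokesRegularity.Theorems.LocalSineTubeDoorProfileAlignedWindowRigidityAncient
open Summit.NavierStokesRegularity.NavierStokesRegularity.Theorems.PoloidalWindowDoorLrcModEntireSheetFlattenTools
open Summit.NavierStokesRegularity.NavierStokesRegularity.Theorems.PoloidalWindowDoorLrcModEntireParallelWebsIdentity
open Summit.NavierStokesRegularity.NavierStokesRegularity.Theorems.PoloidalWindowDoorLrcModEntireRidgeGlobalBranchODE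
open Summit.NavierStokesRegularity.NavierStokesRegularity.Theorems.PoloidalWindowDoorLrcModEntireRidgeGlobalBranchFrame
open Summit.NavierStokesRegularity.NavierStokesRegularity.Theorems.PoloidalWindowDoorLrcModEntireRidgeClassConstants
open Summit.NavierStokesRegularity.NavierStokesRegularity.Theorems.PoloidalWindowDoorLrcModEntireQ4TimeWebFunction
open Summit.NavierStokesRegularity.NavierStokesRegularity.Theorems.PoloidalWindowDoorLrcModEntireWebPackageAnalytic
open Summit.NavierStokesRegularity.NavierStokesRegularity.Theorems.PoloidalWindowDoorLrcModEntireBaseWebArclength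
open Summit.NavierStokesRegularity.NavierStokesRegularity.Theorems.PoloidalWindowDoorLrcModEntireFermiTimeWebFunction
open Summit.NavierStokesRegularity.NavierStokesRegularity.Theorems.PoloidalWindowDoorLrcModEntireFermiTimeWebGeometry
open Summit.NavierStokesRegularity.NavierStokesRegularity.Theorems.PoloidalWindowDoorLrcModEntireCurvedWebHuygens
open Summit.NavierStokesRegularity.NavierStokesRegularity.Theorems.PoloidalWindowDoorLrcModEntireCurvedHuygensLocal

variable {C : ℝ} {U : ℝ → EuclideanSpace ℝ (Fin 3) → EuclideanSpace ℝ (Fin 3)}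

/-- ★★ **THE CURVED TIME-WEB PACKAGE AT A GENERAL BASE TIME `τ₁` (B-TWPc).**  See the module docstring. -/
theorem fermi_timeWeb_package
    (hUrate : HasTypeITimeDecay C U) (hUcont : ContinuousOn (uncurry U) (Iio (0 : ℝ) ×ˢ univ))
    (hUmild : ∀ s t : ℝ, s < t → t < 0 → ∀ x, U t x = heatExtension (U s) (t - s) x - oseenDuhamel 1 s U U t x)
    (hUdiv : ∀ t < 0, VectorCalculus.IsDivFree (U t))
    {σ : ℝ} {ρ : ℝ} {μ : ℝ → ℝ → ℝ} (hμ3 : ContDiff ℝ 3 (uncurry μ))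
    (hslabU : ∀ t : ℝ, |t + 1| < ρ → ∀ x : EuclideanSpace ℝ (Fin 3), |x 2| < ρ → ∀ b : Fin 3, b ≠ 2 →
      fderiv ℝ (U t) x (EuclideanSpace.single 2 1) b = μ t (x 2) * fderiv ℝ (U t) x (EuclideanSpace.single b 1) 2)
    {e : EuclideanSpace ℝ (Fin 3)} (he2 : e 2 = 0) (hunit : e 0 ^ 2 + e 1 ^ 2 = 1)
    {r δ δ' : ℝ} {R : ℝ → ℝ → ℝ} {n₀ : ℝ × ℝ × ℝ → ℝ} {κt : ℝ → ℝ → ℝ} (hδ'δ : δ' ≤ δ) (hδ'ρ : δ' ≤ ρ) (hδ'h : δ' < 1 / 2)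
    (hconcF : ∀ τ z : ℝ, |τ| < δ → |z| < δ → ∀ s : ℝ, ∀ n ∈ Ioo (-r) r,
      fderiv ℝ (fderiv ℝ (fun y => σ * U (-1 + τ) y 2)) (frameCLM e (s, n, z)) (Jvec e) (Jvec e) < 0)
    (hpack : ∀ q : ℝ × ℝ × ℝ, |q.1| < δ' → |q.2.2| < δ' →
      n₀ q ∈ Ioo (-r) r ∧
      σ * U (-1 + q.1) (frameCLM e (q.2.1, n₀ q, q.2.2)) 2 = R q.1 q.2.2 ∧
      (∀ n ∈ Icc (-r) r, n ≠ n₀ q → σ * U (-1 + q.1) (frameCLM e (q.2.1, n, q.2.2)) 2 < R q.1 q.2.2) ∧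
      (∀ w : EuclideanSpace ℝ (Fin 3), w 2 = 0 → fderiv ℝ (fun y => U (-1 + q.1) y 2) (frameCLM e (q.2.1, n₀ q, q.2.2)) w = 0) ∧
      (∀ m : ℕ∞, ContDiffAt ℝ m n₀ q) ∧
      0 < κt q.1 q.2.2 ∧
      fderiv ℝ (fderiv ℝ (fun y => σ * U (-1 + q.1) y 2)) (frameCLM e (q.2.1, n₀ q, q.2.2)) e e +
          fderiv ℝ (fderiv ℝ (fun y => σ * U (-1 + q.1) y 2)) (frameCLM e (q.2.1, n₀ q, q.2.2)) (Jvec e) (Jvec e) =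
        -κt q.1 q.2.2 ∧
      κt q.1 q.2.2 * (fderiv ℝ n₀ q ((0 : ℝ), (0 : ℝ), (1 : ℝ))) ^ 2 =
        (deriv (deriv (R q.1)) q.2.2 - μ (-1 + q.1) q.2.2 * κt q.1 q.2.2) * (1 + (fderiv ℝ n₀ q ((0 : ℝ), (1 : ℝ), (0 : ℝ))) ^ 2))
    {τ₁ : ℝ} (hτ₁ : |τ₁| < δ') (σ₀ : ℝ)
    -- the unit-speed base web of time `τ₁` (T1 `…BaseWebArclength.exists_unitSpeed_graph` with `g = n₀(τ₁,·,0)`), by value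
    {Γ : ℝ → EuclideanSpace ℝ (Fin 3)} {φ k₁ : ℝ → ℝ} (hΓcd : ContDiff ℝ ∞ Γ) (hφ : ContDiff ℝ ∞ φ) (hk₁ : ContDiff ℝ ∞ k₁)
    (hΓφ : ∀ s, Γ s = φ s • e + n₀ (τ₁, φ s, 0) • Jvec e) (hΓ2 : ∀ s, Γ s 2 = 0)
    (hΓ' : ∀ s, deriv Γ s = (1 / Real.sqrt (1 + deriv (fun s' => n₀ (τ₁, s', 0)) (φ s) ^ 2)) •
      (e + deriv (fun s' => n₀ (τ₁, s', 0)) (φ s) • Jvec e))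
    (hΓunit : ∀ s, ‖deriv Γ s‖ = 1) (hfrenet : ∀ s, deriv (deriv Γ) s = k₁ s • rotJ (deriv Γ s)) :
    ∃ ε₁ : ℝ, 0 < ε₁ ∧ ∃ G₁ S : ℝ × ℝ × ℝ → ℝ,
      ContDiffOn ℝ ∞ G₁ {q : ℝ × ℝ × ℝ | |q.1 - τ₁| < ε₁ ∧ |q.2.1 - σ₀| < ε₁ ∧ |q.2.2| < ε₁} ∧
      (∀ s : ℝ, |s - σ₀| < ε₁ → G₁ (τ₁, s, 0) = 0) ∧
      (∀ q : ℝ × ℝ × ℝ, |q.1 - τ₁| < ε₁ → |q.2.1 - σ₀| < ε₁ → |q.2.2| < ε₁ →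
        |q.1| < δ' ∧ |q.2.2| < δ' ∧ 1 - k₁ q.2.1 * G₁ q ≠ 0 ∧
        -- the Fermi point IS the line-frame web point at the line parameter `S q` (so every conjunct of `hpack` / the web Fermat law applies at it)
        Γ q.2.1 + G₁ q • rotJ (deriv Γ q.2.1) + q.2.2 • e2 = frameCLM e (S q, n₀ (q.1, S q, q.2.2), q.2.2) ∧
        -- criticality, value, ridge law, slice law at the Fermi point
        fderiv ℝ (fun y => σ * U (-1 + q.1) y 2) (Γ q.2.1 + G₁ q • rotJ (deriv Γ q.2.1) + q.2.2 • e2) (rotJ (deriv Γ q.2.1)) = 0 ∧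
        fderiv ℝ (fun y => σ * U (-1 + q.1) y 2) (Γ q.2.1 + G₁ q • rotJ (deriv Γ q.2.1) + q.2.2 • e2) (deriv Γ q.2.1) = 0 ∧
        σ * U (-1 + q.1) (Γ q.2.1 + G₁ q • rotJ (deriv Γ q.2.1) + q.2.2 • e2) 2 = R q.1 q.2.2 ∧
        fderiv ℝ (fderiv ℝ (fun y => σ * U (-1 + q.1) y 2)) (Γ q.2.1 + G₁ q • rotJ (deriv Γ q.2.1) + q.2.2 • e2) (deriv Γ q.2.1) (deriv Γ q.2.1) +
            fderiv ℝ (fderiv ℝ (fun y => σ * U (-1 + q.1) y 2)) (Γ q.2.1 + G₁ q • rotJ (deriv Γ q.2.1) + q.2.2 • e2)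
              (rotJ (deriv Γ q.2.1)) (rotJ (deriv Γ q.2.1)) = -κt q.1 q.2.2 ∧
        fderiv ℝ (fderiv ℝ (fun y => σ * U (-1 + q.1) y 2)) (Γ q.2.1 + G₁ q • rotJ (deriv Γ q.2.1) + q.2.2 • e2) e2 e2 =
          -μ (-1 + q.1) q.2.2 *
            (fderiv ℝ (fderiv ℝ (fun y => σ * U (-1 + q.1) y 2)) (Γ q.2.1 + G₁ q • rotJ (deriv Γ q.2.1) + q.2.2 • e2) (deriv Γ q.2.1) (deriv Γ q.2.1) +
              fderiv ℝ (fderiv ℝ (fun y => σ * U (-1 + q.1) y 2)) (Γ q.2.1 + G₁ q • rotJ (deriv Γ q.2.1) + q.2.2 • e2)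
                (rotJ (deriv Γ q.2.1)) (rotJ (deriv Γ q.2.1))) ∧
        -- the Fermi HUYGENS FAMILY
        κt q.1 q.2.2 * (1 - k₁ q.2.1 * G₁ q) ^ 2 * (fderiv ℝ G₁ q ((0 : ℝ), (0 : ℝ), (1 : ℝ))) ^ 2 =
          (deriv (deriv (R q.1)) q.2.2 - μ (-1 + q.1) q.2.2 * κt q.1 q.2.2) *
            ((1 - k₁ q.2.1 * G₁ q) ^ 2 + (fderiv ℝ G₁ q ((0 : ℝ), (1 : ℝ), (0 : ℝ))) ^ 2)) ∧
      -- PARALLEL WEBS at the base time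
      (∀ s s' z : ℝ, |s - σ₀| < ε₁ → |s' - σ₀| < ε₁ → |z| < ε₁ → G₁ (τ₁, s, z) = G₁ (τ₁, s', z)) := by
  set g : ℝ → ℝ := fun s' => n₀ (τ₁, s', 0) with hg_def
  have hδ'pos : 0 < δ' := lt_of_le_of_lt (abs_nonneg _) hτ₁
  have hδ'h2 : δ' ≤ 1 / 2 := hδ'h.le
  -- the space–time function and its slices
  have hTabs : ∀ τ : ℝ, |τ| < δ' → -1 + τ < 0 := fun τ hτ => by linarith [(abs_lt.1 (lt_trans hτ hδ'h)).2]
  have hθd : ∀ τ : ℝ, |τ| < δ' → Differentiable ℝ (fun y => U (-1 + τ) y 2) := fun τ hτ =>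
    (contDiff_two_vert_at hUrate hUcont hUmild hUdiv (lt_trans hτ hδ'h)).differentiable (by norm_num)
  have hF3 : ∀ τ : ℝ, |τ| < δ' → ContDiff ℝ 3 (fun y => σ * U (-1 + τ) y 2) := fun τ hτ =>
    contDiff_signed_slice hUrate hUcont hUmild hUdiv (hTabs τ hτ) σ
  -- `hpack` ingredients as separate maps
  have hconc' : ∀ τ z : ℝ, |τ| < δ' → |z| < δ' → ∀ s : ℝ, ∀ n ∈ Ioo (-r) r,
      fderiv ℝ (fderiv ℝ (fun y => σ * U (-1 + τ) y 2)) (frameCLM e (s, n, z)) (Jvec e) (Jvec e) < 0 := fun τ z hτ hz =>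
    hconcF τ z (lt_of_lt_of_le hτ hδ'δ) (lt_of_lt_of_le hz hδ'δ)
  have hn₀' : ∀ q : ℝ × ℝ × ℝ, |q.1| < δ' → |q.2.2| < δ' → n₀ q ∈ Ioo (-r) r := fun q h1 h2 => (hpack q h1 h2).1
  have hval' : ∀ q : ℝ × ℝ × ℝ, |q.1| < δ' → |q.2.2| < δ' → σ * U (-1 + q.1) (frameCLM e (q.2.1, n₀ q, q.2.2)) 2 = R q.1 q.2.2 :=
    fun q h1 h2 => (hpack q h1 h2).2.1
  have hcritσ : ∀ q : ℝ × ℝ × ℝ, |q.1| < δ' → |q.2.2| < δ' → ∀ w : EuclideanSpace ℝ (Fin 3), w 2 = 0 →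
      fderiv ℝ (fun y => σ * U (-1 + q.1) y 2) (frameCLM e (q.2.1, n₀ q, q.2.2)) w = 0 := by
    intro q h1 h2 w hw
    have h := (hpack q h1 h2).2.2.2.1 w hw
    rw [show (fun y => σ * U (-1 + q.1) y 2) = fun y => σ * (fun y' => U (-1 + q.1) y' 2) y from rfl,
      fderiv_const_mul (hθd q.1 h1 _) σ]
    simp [h]
  have hcrit' : ∀ q : ℝ × ℝ × ℝ, |q.1| < δ' → |q.2.2| < δ' →
      fderiv ℝ (fun y => σ * U (-1 + q.1) y 2) (frameCLM e (q.2.1, n₀ q, q.2.2)) (Jvec e) = 0 :=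
    fun q h1 h2 => hcritσ q h1 h2 (Jvec e) (by simp [Jvec])
  -- analyticity of the web function and of the ridge height on the `δ′`-box
  have hn₀an : ∀ q : ℝ × ℝ × ℝ, |q.1| < δ' → |q.2.2| < δ' → AnalyticAt ℝ n₀ q := fun q h1 h2 =>
    webFunction_analyticAt hUrate hUcont hUmild hUdiv hδ'h2 hconc' hn₀' hcrit' h1 h2
  have hRan : ∀ τ z : ℝ, |τ| < δ' → |z| < δ' → AnalyticAt ℝ (R τ) z := by
    intro τ z hτ hz
    have h := ridgeHeight_analyticAt hUrate hUcont hUmild hUdiv hδ'h2 hconc' hn₀' hcrit' (R := R) hval' hτ hz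
    exact h.comp_of_eq (analyticAt_const.prod analyticAt_id) rfl
  have hg : ContDiff ℝ ∞ g := contDiff_baseGraph (τ₁ := τ₁) fun s => hn₀an (τ₁, s, 0) hτ₁ (by simpa using hδ'pos)
  /- STEP 1: the local Fermi time-web function (T3b-1). -/
  obtain ⟨ε₁, hε₁, G₁, S, hG₁cd, hpin, hgeom⟩ :=
    exists_fermi_timeWeb_local (δ' := δ') he2 hφ hk₁.continuous hΓφ hΓ' hg (hn₀an (τ₁, φ σ₀, 0) hτ₁ (by simpa using hδ'pos)) hτ₁
  -- the frame at `σ`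
  have hT2 : ∀ s, deriv Γ s 2 = 0 := fun s => by rw [hΓ' s]; simp [Jvec, he2]
  have hν2 : ∀ s, rotJ (deriv Γ s) 2 = 0 := fun s => (rotJ_facts (hT2 s) (hΓunit s)).1
  have heun : ‖e‖ = 1 := by
    have h := norm_sq_eq_sum3 e
    rw [he2] at h
    have h1 : ‖e‖ ^ 2 = 1 := by rw [h]; linear_combination hunit
    nlinarith [norm_nonneg e]
  have htrace : ∀ (B : EuclideanSpace ℝ (Fin 3) →L[ℝ] EuclideanSpace ℝ (Fin 3) →L[ℝ] ℝ) (s : ℝ),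
      B (deriv Γ s) (deriv Γ s) + B (rotJ (deriv Γ s)) (rotJ (deriv Γ s)) = B e e + B (Jvec e) (Jvec e) := by
    intro B s
    rw [frame_trace B (hT2 s) (hΓunit s), Jvec_eq_rotJ, frame_trace B he2 heun]
  /- STEP 2: the identities at the Fermi points. -/
  have hid : ∀ q : ℝ × ℝ × ℝ, |q.1 - τ₁| < ε₁ → |q.2.1 - σ₀| < ε₁ → |q.2.2| < ε₁ →
      |q.1| < δ' ∧ |q.2.2| < δ' ∧ 1 - k₁ q.2.1 * G₁ q ≠ 0 ∧
      fderiv ℝ (fun y => σ * U (-1 + q.1) y 2) (Γ q.2.1 + G₁ q • rotJ (deriv Γ q.2.1) + q.2.2 • e2) (rotJ (deriv Γ q.2.1)) = 0 ∧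
      fderiv ℝ (fun y => σ * U (-1 + q.1) y 2) (Γ q.2.1 + G₁ q • rotJ (deriv Γ q.2.1) + q.2.2 • e2) (deriv Γ q.2.1) = 0 ∧
      σ * U (-1 + q.1) (Γ q.2.1 + G₁ q • rotJ (deriv Γ q.2.1) + q.2.2 • e2) 2 = R q.1 q.2.2 ∧
      fderiv ℝ (fderiv ℝ (fun y => σ * U (-1 + q.1) y 2)) (Γ q.2.1 + G₁ q • rotJ (deriv Γ q.2.1) + q.2.2 • e2) (deriv Γ q.2.1) (deriv Γ q.2.1) +
          fderiv ℝ (fderiv ℝ (fun y => σ * U (-1 + q.1) y 2)) (Γ q.2.1 + G₁ q • rotJ (deriv Γ q.2.1) + q.2.2 • e2)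
            (rotJ (deriv Γ q.2.1)) (rotJ (deriv Γ q.2.1)) = -κt q.1 q.2.2 ∧
      fderiv ℝ (fderiv ℝ (fun y => σ * U (-1 + q.1) y 2)) (Γ q.2.1 + G₁ q • rotJ (deriv Γ q.2.1) + q.2.2 • e2) e2 e2 =
        -μ (-1 + q.1) q.2.2 *
          (fderiv ℝ (fderiv ℝ (fun y => σ * U (-1 + q.1) y 2)) (Γ q.2.1 + G₁ q • rotJ (deriv Γ q.2.1) + q.2.2 • e2) (deriv Γ q.2.1) (deriv Γ q.2.1) +
            fderiv ℝ (fderiv ℝ (fun y => σ * U (-1 + q.1) y 2)) (Γ q.2.1 + G₁ q • rotJ (deriv Γ q.2.1) + q.2.2 • e2)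
              (rotJ (deriv Γ q.2.1)) (rotJ (deriv Γ q.2.1))) := by
    intro q h1 h2 h3
    obtain ⟨hW, hJ, hq1, hq3⟩ := hgeom q h1 h2 h3
    set q' : ℝ × ℝ × ℝ := (q.1, S q, q.2.2) with hq'
    have hq'1 : |q'.1| < δ' := hq1
    have hq'3 : |q'.2.2| < δ' := hq3
    obtain ⟨-, hv, -, -, -, -, hridge, -⟩ := hpack q' hq'1 hq'3
    have hW' : Γ q.2.1 + G₁ q • rotJ (deriv Γ q.2.1) + q.2.2 • e2 = frameCLM e (q'.2.1, n₀ q', q'.2.2) := by rw [hW]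
    refine ⟨hq1, hq3, hJ, ?_, ?_, ?_, ?_, ?_⟩
    · rw [hW']; exact hcritσ q' hq'1 hq'3 _ (hν2 _)
    · rw [hW']; exact hcritσ q' hq'1 hq'3 _ (hT2 _)
    · rw [hW']; exact hv
    · rw [hW', htrace]; exact hridge
    · have hτρ : |q.1| < ρ := lt_of_lt_of_le hq1 hδ'ρ
      have hx : |(Γ q.2.1 + G₁ q • rotJ (deriv Γ q.2.1) + q.2.2 • e2) 2| < ρ := by
        rw [hW', frameCLM_apply_two he2]; exact lt_of_lt_of_le hq3 hδ'ρ
      have h := slice_law_at hUrate hUcont hUmild hUdiv he2 hunit (σ := σ) (lt_trans hq1 hδ'h) hτρ hslabU hx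
      rw [htrace]
      have h2 : (Γ q.2.1 + G₁ q • rotJ (deriv Γ q.2.1) + q.2.2 • e2) 2 = q.2.2 := by rw [hW', frameCLM_apply_two he2]
      rw [h2] at h
      exact h
  /- STEP 3: the Fermi Huygens identity at a fixed time, in slice currency. -/
  have hbox_open : ∀ τ : ℝ, IsOpen {p : ℝ × ℝ | |p.1 - σ₀| < ε₁ ∧ |p.2| < ε₁} := fun _ =>
    (isOpen_lt (continuous_fst.sub continuous_const).abs continuous_const).inter (isOpen_lt continuous_snd.abs continuous_const)
  have hBoxOpen : IsOpen {q : ℝ × ℝ × ℝ | |q.1 - τ₁| < ε₁ ∧ |q.2.1 - σ₀| < ε₁ ∧ |q.2.2| < ε₁} :=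
    (isOpen_lt (continuous_fst.sub continuous_const).abs continuous_const).inter
      ((isOpen_lt ((continuous_fst.comp continuous_snd).sub continuous_const).abs continuous_const).inter
        (isOpen_lt (continuous_snd.comp continuous_snd).abs continuous_const))
  have hG₁d : ∀ q : ℝ × ℝ × ℝ, |q.1 - τ₁| < ε₁ → |q.2.1 - σ₀| < ε₁ → |q.2.2| < ε₁ → DifferentiableAt ℝ G₁ q := fun q h1 h2 h3 =>
    (hG₁cd.contDiffAt (hBoxOpen.mem_nhds ⟨h1, h2, h3⟩)).differentiableAt (by simp)
  have hslice_d : ∀ τ : ℝ, |τ - τ₁| < ε₁ → ∀ p : ℝ × ℝ, |p.1 - σ₀| < ε₁ → |p.2| < ε₁ →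
      HasFDerivAt (fun p' : ℝ × ℝ => G₁ (τ, p')) ((fderiv ℝ G₁ (τ, p)).comp (ContinuousLinearMap.inr ℝ ℝ (ℝ × ℝ))) p :=
    fun τ hτ p h2 h3 => (hG₁d (τ, p) hτ h2 h3).hasFDerivAt.comp p (hasFDerivAt_prodMk_right τ p)
  have hHuy : ∀ τ : ℝ, |τ - τ₁| < ε₁ → ∀ p : ℝ × ℝ, |p.1 - σ₀| < ε₁ → |p.2| < ε₁ →
      κt τ p.2 * (1 - k₁ p.1 * G₁ (τ, p)) ^ 2 * (fderiv ℝ (fun p' : ℝ × ℝ => G₁ (τ, p')) p (0, 1)) ^ 2 =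
        (deriv (deriv (R τ)) p.2 - μ (-1 + τ) p.2 * κt τ p.2) *
          ((1 - k₁ p.1 * G₁ (τ, p)) ^ 2 + (fderiv ℝ (fun p' : ℝ × ℝ => G₁ (τ, p')) p (1, 0)) ^ 2) := by
    intro τ hτ p h2 h3
    have hτδ : |τ| < δ' := (hid (τ, p) hτ h2 h3).1
    refine curved_huygens_identity_on (hF3 τ hτδ) (hΓcd.of_le (by exact WithTop.coe_le_coe.2 le_top)) hΓ2 hfrenet (hbox_open τ)
      (G := fun p' : ℝ × ℝ => G₁ (τ, p')) (fun p' hp' => (hslice_d τ hτ p' hp'.1 hp'.2).differentiableAt)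
      (R := R τ) (κ := κt τ) (μ := fun z => μ (-1 + τ) z)
      (fun p' hp' => ((hRan τ p'.2 hτδ ((hid (τ, p') hτ hp'.1 hp'.2).2.1)).deriv.differentiableAt).hasDerivAt)
      (fun p' hp' => (hRan τ p'.2 hτδ ((hid (τ, p') hτ hp'.1 hp'.2).2.1)).differentiableAt)
      (fun p' hp' => (hid (τ, p') hτ hp'.1 hp'.2).2.2.2.1) (fun p' hp' => (hid (τ, p') hτ hp'.1 hp'.2).2.2.2.2.1)
      (fun p' hp' => (hid (τ, p') hτ hp'.1 hp'.2).2.2.2.2.2.1) (fun p' hp' => (hid (τ, p') hτ hp'.1 hp'.2).2.2.2.2.2.2.1)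
      (fun p' hp' => (hid (τ, p') hτ hp'.1 hp'.2).2.2.2.2.2.2.2) (p := p) ⟨h2, h3⟩
  refine ⟨ε₁, hε₁, G₁, S, hG₁cd, hpin, fun q h1 h2 h3 => ?_, ?_⟩
  · obtain ⟨hq1, hq3, hJ, hcν, hcT, hv, hri, hsl⟩ := hid q h1 h2 h3
    refine ⟨hq1, hq3, hJ, (hgeom q h1 h2 h3).1, hcν, hcT, hv, hri, hsl, ?_⟩
    -- the Huygens family in `G₁`-currency
    have h := hHuy q.1 h1 (q.2.1, q.2.2) h2 h3
    have hd := hslice_d q.1 h1 (q.2.1, q.2.2) h2 h3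
    rw [hd.fderiv] at h
    simpa using h
  · /- STEP 4: parallel webs at the base time (T3a `webFun_eq_of_curved_huygens_on`). -/
    intro s s' z hs hs' hz
    have habsI : ∀ {u c : ℝ}, |u - c| < ε₁ ↔ u ∈ Ioo (c - ε₁) (c + ε₁) := fun {u c} => by
      rw [abs_lt, mem_Ioo]; constructor <;> intro h <;> constructor <;> linarith [h.1, h.2]
    have habs0 : ∀ {u : ℝ}, |u| < ε₁ ↔ u ∈ Ioo (-ε₁) ε₁ := fun {u} => by rw [abs_lt, mem_Ioo]
    have h0τ : |τ₁ - τ₁| < ε₁ := by simpa using hε₁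
    -- smoothness of the base-time slice on the box
    have hG2 : ContDiffOn ℝ 2 (fun p : ℝ × ℝ => G₁ (τ₁, p)) (Ioo (σ₀ - ε₁) (σ₀ + ε₁) ×ˢ Ioo (-ε₁) ε₁) := by
      have hι : ContDiff ℝ ∞ (fun p : ℝ × ℝ => ((τ₁, p) : ℝ × ℝ × ℝ)) := contDiff_const.prodMk contDiff_id
      refine ((hG₁cd.of_le (by exact WithTop.coe_le_coe.2 le_top)).comp (hι.of_le (by exact WithTop.coe_le_coe.2 le_top)).contDiffOn fun p hp => ?_)
      exact ⟨h0τ, habsI.2 hp.1, habs0.2 hp.2⟩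
    -- `κt(τ₁,·)` is differentiable: it is minus the frame trace of the Hessian at the web point `(τ₁, 0, z)`
    set T : Set ℝ := Ioo (-1 / 2 : ℝ) (1 / 2) with hT_def
    obtain ⟨F, hF_def⟩ : ∃ F : ℝ → EuclideanSpace ℝ (Fin 3) → ℝ, F = fun τ y => σ * U (-1 + τ) y 2 := ⟨_, rfl⟩
    have hF : IsSmoothSpaceTimeOn T F := by
      have h := contDiffOn_uncurry_signed hUrate hUcont hUmild hUdiv σ (n := ⊤) (T := T) Subset.rfl
      rw [hF_def]; exact h
    have hτ₁T : τ₁ ∈ T := ⟨by linarith [(abs_lt.1 (lt_trans hτ₁ hδ'h)).1], (abs_lt.1 (lt_trans hτ₁ hδ'h)).2⟩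
    have hκd : ∀ z ∈ Ioo (-ε₁) ε₁, DifferentiableAt ℝ (κt τ₁) z := by
      intro z hz
      have hzδ : |z| < δ' := (hid (τ₁, σ₀, z) h0τ (by simpa using hε₁) (habs0.2 hz)).2.1
      set wpt : ℝ → EuclideanSpace ℝ (Fin 3) := fun z' => frameCLM e ((0 : ℝ), n₀ (τ₁, 0, z'), z') with hwpt
      have hwd : DifferentiableAt ℝ wpt z := by
        have hn : DifferentiableAt ℝ (fun z' : ℝ => n₀ (τ₁, 0, z')) z :=
          (hn₀an (τ₁, 0, z) hτ₁ hzδ).differentiableAt.comp z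
            ((differentiableAt_const _).prodMk ((differentiableAt_const _).prodMk differentiableAt_id))
        have h3 : DifferentiableAt ℝ (fun z' : ℝ => (((0 : ℝ), n₀ (τ₁, 0, z'), z') : ℝ × ℝ × ℝ)) z :=
          (differentiableAt_const _).prodMk (hn.prodMk differentiableAt_id)
        exact (frameCLM e).differentiableAt.comp z h3
      have hdiff : DifferentiableAt ℝ (fun z' => -(fderiv ℝ (fderiv ℝ (F τ₁)) (wpt z') e e + fderiv ℝ (fderiv ℝ (F τ₁)) (wpt z') (Jvec e) (Jvec e))) z :=
        ((differentiableAt_sliceHessian_comp hF hτ₁T hwd e e).add (differentiableAt_sliceHessian_comp hF hτ₁T hwd (Jvec e) (Jvec e))).neg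
      refine (Filter.EventuallyEq.differentiableAt_iff ?_).1 hdiff
      have hopen : IsOpen (Ioo (-δ') δ') := isOpen_Ioo
      filter_upwards [hopen.mem_nhds (show z ∈ Ioo (-δ') δ' from ⟨by linarith [(abs_lt.1 hzδ).1], (abs_lt.1 hzδ).2⟩)] with z' hz'
      have hz'δ : |z'| < δ' := abs_lt.2 ⟨hz'.1, hz'.2⟩
      have h6 := (hpack (τ₁, (0 : ℝ), z') hτ₁ hz'δ).2.2.2.2.2.2.1
      rw [hF_def]; simp only [hwpt] at h6 ⊢
      linarith
    have hμd : ∀ z ∈ Ioo (-ε₁) ε₁, DifferentiableAt ℝ (fun z' => μ (-1 + τ₁) z') z := fun z _ =>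
      (hμ3.differentiable (by norm_num) _).comp z ((differentiableAt_const _).prodMk differentiableAt_id)
    have hcd : ∀ z ∈ Ioo (-ε₁) ε₁, DifferentiableAt ℝ (fun z' => deriv (deriv (R τ₁)) z' - μ (-1 + τ₁) z' * κt τ₁ z') z := by
      intro z hz
      have hzδ : |z| < δ' := (hid (τ₁, σ₀, z) h0τ (by simpa using hε₁) (habs0.2 hz)).2.1
      exact ((hRan τ₁ z hτ₁ hzδ).deriv.deriv.differentiableAt).sub ((hμd z hz).mul (hκd z hz))
    have hpar := webFun_eq_of_curved_huygens_on (G := fun p : ℝ × ℝ => G₁ (τ₁, p)) (a := σ₀ - ε₁) (b := σ₀ + ε₁) hε₁ hG2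
      (κ := κt τ₁) (c := fun z' => deriv (deriv (R τ₁)) z' - μ (-1 + τ₁) z' * κt τ₁ z') (k := k₁)
      (fun z hz => (hpack (τ₁, σ₀, z) hτ₁ (hid (τ₁, σ₀, z) h0τ (by simpa using hε₁) (habs0.2 hz)).2.1).2.2.2.2.2.1)
      hκd hcd (hk₁.differentiable (by simp))
      (fun p hp => (hid (τ₁, p) h0τ (habsI.2 hp.1) (habs0.2 hp.2)).2.2.1)
      (fun p hp => hHuy τ₁ h0τ p (habsI.2 hp.1) (habs0.2 hp.2))
      (fun s₁ hs₁ => hpin s₁ (habsI.2 hs₁))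
    exact hpar s (habsI.1 hs) s' (habsI.1 hs') z (habs0.1 hz)

end Summit.NavierStokesRegularity.NavierStokesRegularity.Theorems.PoloidalWindowDoorLrcModEntireFermiTimeWebPackage

end
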